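import Mathlib
import Literature.Geometry.Lorentzian.KerrSchildWaveCauchyProblem
import Summits.FinalStateConjecture.FinalStateConjecture.Theorems.StarvedNecksNecksCertifyStubHuygensNeckWave

/-!
# Route StarvedNecks — crux `NecksCertify`, line `two-cap-focusing-ledger`: stub M2, the cutoff

Helper file for `stub_huygensNeck` (the Huygens neck lemma): the cylindrical cutoff and the source
bound.  Given `φ : E4 → ℝ` smooth with `□_η φ = 0` on `{y⁰ ≥ T, |ȳ| ≥ R₀}`, we produce
`ψ := χ(|ȳ|) φ` with a smooth cutoff `χ = 0` on `|ȳ| < R₀ + 1/3`, `χ = 1` on `|ȳ| > R₀ + 2/3`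
(`1 −` a `ContDiffBump` of `E3`, pulled back along `E4.spatial`), and prove, for `m ≤ 2` and
`g = (y ↦ Dᵐψ(y)·v)`:

* `g` is smooth and `Dg(z)·h = Dᵐ⁺¹ψ(z)(h, v)` is bounded by `‖Dᵐ⁺¹ψ(z)‖ ‖h‖ ∏‖vᵢ‖`;
* `□_η g (y) = 0` if `|ȳ| < R₀ + 1/3`, or if `y⁰ > T` and `|ȳ| > R₀ + 2/3`;
* `|□_η g (y)| ≤ K (∑_{j ≤ 3} ‖Dʲφ(y)‖) ∏‖vᵢ‖` for `y⁰ > T` (the top-order terms cancel: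
  `□(χφ) = φ □χ + 2η(dχ, dφ)` there).

Mathlib plus the wave calculus of `…StubHuygensNeckWave`; no definitions, no named facts.
-/

noncomputable section

namespace Summit.FinalStateConjecture.FinalStateConjecture.Theorems.NecksCertifyTwoCap.Huygens

open scoped ContDiff Topology
open Filter Set Literature.Geometry.Lorentzian

set_option linter.dupNamespace false

/-! ### A smooth cylindrical cutoff -/

/-- A smooth function on `E3` which is `0` on `‖x‖ < a`, `1` on `‖x‖ > b` (`0 < a < b`), with all
derivatives of order `≤ 4` bounded. -/
theorem exists_cutoff_E3 {a b : ℝ} (ha : 0 < a) (hab : a < b) :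
    ∃ χ : E3 → ℝ, ContDiff ℝ ∞ χ ∧
      (∀ x, ‖x‖ < a → χ =ᶠ[𝓝 x] fun _ ↦ 0) ∧
      (∀ x, b < ‖x‖ → χ =ᶠ[𝓝 x] fun _ ↦ 1) ∧
      ∃ K : ℝ, ∀ j ≤ 4, ∀ x, ‖iteratedFDeriv ℝ j χ x‖ ≤ K := by
  let f : ContDiffBump (0 : E3) := ⟨a, b, ha, hab⟩
  refine ⟨fun x ↦ 1 - f x, contDiff_const.sub f.contDiff, ?_, ?_, ?_⟩
  · intro x hx
    have h1 : (f : E3 → ℝ) =ᶠ[𝓝 x] 1 :=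
      f.eventuallyEq_one_of_mem_ball (by simpa using hx)
    filter_upwards [h1] with y hy
    simp [hy]
  · intro x hx
    have hopen : IsOpen {y : E3 | b < ‖y‖} := isOpen_lt continuous_const continuous_norm
    filter_upwards [hopen.mem_nhds hx] with y hy
    have : f y = 0 := f.zero_of_le_dist (by simpa using (le_of_lt hy))
    simp [this]
  · -- derivative bounds: continuity on a compact ball, and `χ = 1` outside
    have hχ : ContDiff ℝ ∞ fun x ↦ 1 - f x := contDiff_const.sub f.contDiff
    have hbound : ∀ j : ℕ, ∃ K : ℝ, ∀ x, ‖iteratedFDeriv ℝ j (fun x ↦ 1 - f x) x‖ ≤ K := by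
      intro j
      have hcont : Continuous fun x ↦ ‖iteratedFDeriv ℝ j (fun x ↦ 1 - f x) x‖ :=
        (hχ.continuous_iteratedFDeriv (by exact_mod_cast le_top)).norm
      obtain ⟨K, hK⟩ := (isCompact_closedBall (0 : E3) b).exists_bound_of_continuousOn
        hcont.continuousOn
      refine ⟨max K 1, fun x ↦ ?_⟩
      by_cases hx : x ∈ Metric.closedBall (0 : E3) b
      · have := hK x hx
        rw [Real.norm_eq_abs, abs_of_nonneg (norm_nonneg _)] at this
        exact this.trans (le_max_left _ _)
      · have hx' : b < ‖x‖ := by simpa [Metric.mem_closedBall, dist_zero_right] using hx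
        have hopen : IsOpen {y : E3 | b < ‖y‖} := isOpen_lt continuous_const continuous_norm
        have hev : (fun x ↦ 1 - f x) =ᶠ[𝓝 x] fun _ ↦ (1 : ℝ) := by
          filter_upwards [hopen.mem_nhds hx'] with y hy
          have : f y = 0 := f.zero_of_le_dist (by simpa using (le_of_lt hy))
          simp [this]
        rw [(hev.iteratedFDeriv ℝ j).eq_of_nhds]
        refine le_trans ?_ (le_max_right _ _)
        rcases Nat.eq_zero_or_pos j with hj | hj
        · subst hj
          simp
        · rw [iteratedFDeriv_const_of_ne (Nat.pos_iff_ne_zero.1 hj)]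
          simp
    choose K hK using hbound
    refine ⟨∑ j ∈ Finset.range 5, |K j|, fun j hj x ↦ ?_⟩
    calc ‖iteratedFDeriv ℝ j (fun x ↦ 1 - f x) x‖ ≤ K j := hK j x
      _ ≤ |K j| := le_abs_self _
      _ ≤ ∑ j ∈ Finset.range 5, |K j| :=
        Finset.single_le_sum (f := fun j ↦ |K j|) (fun _ _ ↦ abs_nonneg _)
          (Finset.mem_range.2 (by omega))

/-- The **cylindrical cutoff** on `E4`: smooth, `0` on `|ȳ| < a`, `1` on `|ȳ| > b`, with all
derivatives of order `≤ 4` bounded. -/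
theorem exists_cutoff_E4 {a b : ℝ} (ha : 0 < a) (hab : a < b) :
    ∃ χ : E4 → ℝ, ContDiff ℝ ∞ χ ∧
      (∀ y, E4.spatialNorm y < a → χ =ᶠ[𝓝 y] fun _ ↦ 0) ∧
      (∀ y, b < E4.spatialNorm y → χ =ᶠ[𝓝 y] fun _ ↦ 1) ∧
      ∃ K : ℝ, 0 ≤ K ∧ ∀ j ≤ 4, ∀ y, ‖iteratedFDeriv ℝ j χ y‖ ≤ K := by
  obtain ⟨χ, hχ, h0, h1, K, hK⟩ := exists_cutoff_E3 ha hab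
  refine ⟨χ ∘ E4.spatial, hχ.comp E4.spatial.contDiff, ?_, ?_, ?_⟩
  · intro y hy
    exact (E4.spatial.continuous.tendsto y).eventually (h0 _ hy) |>.mono fun z hz ↦ by
      simpa using hz
  · intro y hy
    exact (E4.spatial.continuous.tendsto y).eventually (h1 _ hy) |>.mono fun z hz ↦ by
      simpa using hz
  · have hK0 : 0 ≤ K := (norm_nonneg _).trans (hK 0 (by norm_num) 0)
    refine ⟨K * (1 + ‖E4.spatial‖) ^ 4, by positivity, fun j hj y ↦ ?_⟩
    rw [E4.spatial.iteratedFDeriv_comp_right hχ y (by exact_mod_cast le_top)]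
    calc ‖(iteratedFDeriv ℝ j χ (E4.spatial y)).compContinuousLinearMap fun _ ↦ E4.spatial‖
        ≤ ‖iteratedFDeriv ℝ j χ (E4.spatial y)‖ * ∏ _i : Fin j, ‖E4.spatial‖ :=
          ContinuousMultilinearMap.norm_compContinuousLinearMap_le _ _
      _ ≤ K * (1 + ‖E4.spatial‖) ^ 4 := by
          rw [Finset.prod_const, Finset.card_univ, Fintype.card_fin]
          gcongr
          · exact hK j hj _
          · calc ‖E4.spatial‖ ^ j ≤ (1 + ‖E4.spatial‖) ^ j := by gcongr; linarith
              _ ≤ (1 + ‖E4.spatial‖) ^ 4 :=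
                pow_le_pow_right₀ (by linarith [norm_nonneg E4.spatial]) hj

/-! ### Derivatives of `y ↦ Dᵐu(y)·v` -/

/-- `y ↦ Dᵐu(y)·v` is smooth for smooth `u`. -/
theorem contDiff_iteratedFDeriv_apply {u : E4 → ℝ} (hu : ContDiff ℝ ∞ u) {m : ℕ}
    (v : Fin m → E4) : ContDiff ℝ ∞ fun y ↦ iteratedFDeriv ℝ m u y v :=
  (ContinuousMultilinearMap.apply ℝ (fun _ : Fin m ↦ E4) ℝ v).contDiff.comp
    (hu.iteratedFDeriv_right (m := ∞) (by exact_mod_cast le_top))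

/-- **`|D(y ↦ Dᵐu(y)·v)(z)·h| ≤ ‖Dᵐ⁺¹u(z)‖ ‖h‖ ∏‖vᵢ‖`**. -/
theorem norm_fderiv_iteratedFDeriv_apply_le {u : E4 → ℝ} (hu : ContDiff ℝ ∞ u) {m : ℕ}
    (v : Fin m → E4) (z h : E4) :
    ‖fderiv ℝ (fun y ↦ iteratedFDeriv ℝ m u y v) z h‖ ≤
      ‖iteratedFDeriv ℝ (m + 1) u z‖ * ‖h‖ * ∏ i, ‖v i‖ := by
  have hd : DifferentiableAt ℝ (iteratedFDeriv ℝ m u) z :=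
    (hu.differentiable_iteratedFDeriv (m := m) (by exact_mod_cast WithTop.coe_lt_top _)) z
  rw [fderiv_continuousMultilinear_apply_const_apply hd v h]
  calc ‖(fderiv ℝ (iteratedFDeriv ℝ m u) z h) v‖
      ≤ ‖fderiv ℝ (iteratedFDeriv ℝ m u) z h‖ * ∏ i, ‖v i‖ :=
        ContinuousMultilinearMap.le_opNorm _ _
    _ ≤ ‖fderiv ℝ (iteratedFDeriv ℝ m u) z‖ * ‖h‖ * ∏ i, ‖v i‖ :=
        mul_le_mul_of_nonneg_right (ContinuousLinearMap.le_opNorm _ _)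
          (Finset.prod_nonneg fun i _ ↦ norm_nonneg (v i))
    _ = ‖iteratedFDeriv ℝ (m + 1) u z‖ * ‖h‖ * ∏ i, ‖v i‖ := by
        rw [norm_fderiv_iteratedFDeriv]

/-- `|Dᵐu(z)·v| ≤ ‖Dᵐu(z)‖ ∏‖vᵢ‖`. -/
theorem abs_iteratedFDeriv_apply_le (u : E4 → ℝ) {m : ℕ} (v : Fin m → E4) (z : E4) :
    |iteratedFDeriv ℝ m u z v| ≤ ‖iteratedFDeriv ℝ m u z‖ * ∏ i, ‖v i‖ := by
  rw [← Real.norm_eq_abs]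
  exact ContinuousMultilinearMap.le_opNorm _ _

/-! ### Leibniz-type bounds -/

/-- Binomial coefficients `C(m, i) ≤ 4` for `m ≤ 2`. -/
theorem choose_le_four {m i : ℕ} (hm : m ≤ 2) : (m.choose i : ℝ) ≤ 4 := by
  have h : m.choose i ≤ 2 ^ m := Nat.choose_le_two_pow m i
  have h2 : 2 ^ m ≤ 2 ^ 2 := Nat.pow_le_pow_right (by norm_num) hm
  exact_mod_cast h.trans h2

/-- Leibniz bound for a product `φ · w` with `‖Dᵏw‖ ≤ K₁` (`k ≤ 2`):
`‖Dᵐ(φ w)(y)‖ ≤ 4 K₁ ∑_{j<4} ‖Dʲφ(y)‖` for `m ≤ 2`. -/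
theorem norm_iteratedFDeriv_mul_bdd_le {φ w : E4 → ℝ} (hφ : ContDiff ℝ ∞ φ) (hw : ContDiff ℝ ∞ w)
    {K₁ : ℝ} (hK₁ : ∀ k ≤ 2, ∀ y, ‖iteratedFDeriv ℝ k w y‖ ≤ K₁) {m : ℕ} (hm : m ≤ 2) (y : E4) :
    ‖iteratedFDeriv ℝ m (fun y ↦ φ y * w y) y‖ ≤
      4 * K₁ * ∑ j ∈ Finset.range 4, ‖iteratedFDeriv ℝ j φ y‖ := by
  have hK0 : 0 ≤ K₁ := (norm_nonneg _).trans (hK₁ 0 (by norm_num) y)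
  calc ‖iteratedFDeriv ℝ m (fun y ↦ φ y * w y) y‖
      ≤ ∑ i ∈ Finset.range (m + 1), (m.choose i : ℝ) * ‖iteratedFDeriv ℝ i φ y‖ *
          ‖iteratedFDeriv ℝ (m - i) w y‖ :=
        norm_iteratedFDeriv_mul_le hφ hw y (by exact_mod_cast le_top)
    _ ≤ ∑ i ∈ Finset.range (m + 1), 4 * ‖iteratedFDeriv ℝ i φ y‖ * K₁ := by
        refine Finset.sum_le_sum fun i _ ↦ ?_
        gcongr
        · exact choose_le_four hm
        · exact hK₁ _ (by omega) _
    _ = 4 * K₁ * ∑ i ∈ Finset.range (m + 1), ‖iteratedFDeriv ℝ i φ y‖ := by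
        rw [Finset.mul_sum]
        refine Finset.sum_congr rfl fun i _ ↦ by ring
    _ ≤ 4 * K₁ * ∑ j ∈ Finset.range 4, ‖iteratedFDeriv ℝ j φ y‖ :=
        mul_le_mul_of_nonneg_left (Finset.sum_le_sum_of_subset_of_nonneg
            (Finset.range_subset_range.2 (by omega)) fun j _ _ ↦
              norm_nonneg (iteratedFDeriv ℝ j φ y)) (by positivity)

/-- Leibniz bound for `w · ∂_a φ` with `‖Dᵏw‖ ≤ K₁` (`k ≤ 2`), `‖a‖ = 1`:
`‖Dᵐ(w ∂_aφ)(y)‖ ≤ 12 K₁ ∑_{j<4} ‖Dʲφ(y)‖` for `m ≤ 2`. -/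
theorem norm_iteratedFDeriv_bdd_mul_dir_le {φ w : E4 → ℝ} (hφ : ContDiff ℝ ∞ φ)
    (hw : ContDiff ℝ ∞ w) {K₁ : ℝ} (hK₁ : ∀ k ≤ 2, ∀ y, ‖iteratedFDeriv ℝ k w y‖ ≤ K₁)
    {a : E4} (ha : ‖a‖ = 1) {m : ℕ} (hm : m ≤ 2) (y : E4) :
    ‖iteratedFDeriv ℝ m (fun y ↦ w y * fderiv ℝ φ y a) y‖ ≤
      12 * K₁ * ∑ j ∈ Finset.range 4, ‖iteratedFDeriv ℝ j φ y‖ := by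
  have hK0 : 0 ≤ K₁ := (norm_nonneg _).trans (hK₁ 0 (by norm_num) y)
  have hφa := contDiff_dir hφ a
  calc ‖iteratedFDeriv ℝ m (fun y ↦ w y * fderiv ℝ φ y a) y‖
      ≤ ∑ i ∈ Finset.range (m + 1), (m.choose i : ℝ) * ‖iteratedFDeriv ℝ i w y‖ *
          ‖iteratedFDeriv ℝ (m - i) (fun y ↦ fderiv ℝ φ y a) y‖ :=
        norm_iteratedFDeriv_mul_le hw hφa y (by exact_mod_cast le_top)
    _ ≤ ∑ i ∈ Finset.range (m + 1), 4 * K₁ * ‖iteratedFDeriv ℝ (m - i + 1) φ y‖ := by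
        refine Finset.sum_le_sum fun i hi ↦ ?_
        have hi' := Finset.mem_range.1 hi
        have h3 := norm_iteratedFDeriv_dir_le hφ a (m - i) y
        rw [ha, one_mul] at h3
        gcongr
        · exact choose_le_four hm
        · exact hK₁ _ (by omega) _
    _ ≤ ∑ i ∈ Finset.range (m + 1), 4 * K₁ * ∑ j ∈ Finset.range 4, ‖iteratedFDeriv ℝ j φ y‖ := by
        refine Finset.sum_le_sum fun i hi ↦ ?_
        gcongr
        exact Finset.single_le_sum (f := fun j ↦ ‖iteratedFDeriv ℝ j φ y‖)
          (fun _ _ ↦ norm_nonneg _) (Finset.mem_range.2 (by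
            have := Finset.mem_range.1 hi; omega))
    _ = (m + 1) * (4 * K₁ * ∑ j ∈ Finset.range 4, ‖iteratedFDeriv ℝ j φ y‖) := by
        rw [Finset.sum_const, Finset.card_range]; simp
    _ ≤ 3 * (4 * K₁ * ∑ j ∈ Finset.range 4, ‖iteratedFDeriv ℝ j φ y‖) := by
        gcongr
        · exact mul_nonneg (by positivity) (Finset.sum_nonneg fun _ _ ↦ norm_nonneg _)
        · have : (m : ℝ) ≤ 2 := by exact_mod_cast hm
          linarith
    _ = 12 * K₁ * ∑ j ∈ Finset.range 4, ‖iteratedFDeriv ℝ j φ y‖ := by ring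

/-! ### The cutoff field and its source -/

/-- **The cutoff field and the source bound.**  For `φ` smooth with `□_η φ = 0` on
`{y⁰ ≥ T, |ȳ| ≥ R₀}` there is a smooth `ψ` (`= χ(|ȳ|)φ`) agreeing with `φ` near every point with
`|ȳ| > R₀ + 2/3`, and a constant `K ≥ 0`, such that for `m ≤ 2`, `v ∈ E4^m` and
`g = (y ↦ Dᵐψ(y)·v)`: `|□_η g(y)| ≤ K (∑_{j<4} ‖Dʲφ(y)‖) ∏‖vᵢ‖` whenever `y⁰ > T`; `□_η g(y) = 0`
whenever `|ȳ| < R₀ + 1/3`; and `□_η g(y) = 0` whenever `y⁰ > T` and `|ȳ| > R₀ + 2/3`. -/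
theorem exists_cutoff_source {φ : E4 → ℝ} {T R₀ : ℝ} (hR₀ : 0 < R₀) (hφ : ContDiff ℝ ∞ φ)
    (hwave : ∀ y : E4, T ≤ y 0 → R₀ ≤ E4.spatialNorm y →
      KerrSchild.waveOperator (fun _ ↦ Kerr.etaComp) φ y = 0) :
    ∃ ψ : E4 → ℝ, ContDiff ℝ ∞ ψ ∧
      (∀ y, R₀ + 2 / 3 < E4.spatialNorm y → ψ =ᶠ[𝓝 y] φ) ∧
      ∃ K : ℝ, 0 ≤ K ∧ ∀ (m : ℕ), m ≤ 2 → ∀ (v : Fin m → E4) (y : E4),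
        (T < y 0 →
          |KerrSchild.waveOperator (fun _ ↦ Kerr.etaComp)
              (fun z ↦ iteratedFDeriv ℝ m ψ z v) y| ≤
            K * (∑ j ∈ Finset.range 4, ‖iteratedFDeriv ℝ j φ y‖) * ∏ i, ‖v i‖) ∧
        (E4.spatialNorm y < R₀ + 1 / 3 →
          KerrSchild.waveOperator (fun _ ↦ Kerr.etaComp)
            (fun z ↦ iteratedFDeriv ℝ m ψ z v) y = 0) ∧
        (T < y 0 → R₀ + 2 / 3 < E4.spatialNorm y →
          KerrSchild.waveOperator (fun _ ↦ Kerr.etaComp)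
            (fun z ↦ iteratedFDeriv ℝ m ψ z v) y = 0) := by
  obtain ⟨χ, hχ, hχ0, hχ1, K₀, hK₀0, hK₀⟩ :=
    exists_cutoff_E4 (a := R₀ + 1 / 3) (b := R₀ + 2 / 3) (by linarith) (by linarith)
  have hψ : ContDiff ℝ ∞ fun y ↦ χ y * φ y := hχ.mul hφ
  have hψφ : ∀ y, R₀ + 2 / 3 < E4.spatialNorm y → (fun y ↦ χ y * φ y) =ᶠ[𝓝 y] φ := by
    intro y hy
    filter_upwards [hχ1 y hy] with z hz
    simp [hz]
  refine ⟨fun y ↦ χ y * φ y, hψ, hψφ, 112 * K₀, by positivity, ?_⟩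
  intro m hm v y
  have hc0 : Continuous fun y : E4 ↦ y 0 := PiLp.continuous_apply 2 _ 0
  -- the commuted operator
  have key := congrFun (waveEta_iteratedFDeriv_comm hψ v) y
  simp only at key
  -- the source identity on `{y⁰ > T}`
  have hsource : ∀ z : E4, T < z 0 →
      KerrSchild.waveOperator (fun _ ↦ Kerr.etaComp) (fun y ↦ χ y * φ y) z =
        φ z * KerrSchild.waveOperator (fun _ ↦ Kerr.etaComp) χ z +
          (2 : ℝ) • ∑ μ, Kerr.etaComp μ μ * fderiv ℝ χ z (E4.basisVector μ) *
            fderiv ℝ φ z (E4.basisVector μ) := by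
    intro z hz
    rw [congrFun (waveEta_mul hχ hφ) z, smul_eq_mul]
    suffices h0 : χ z * KerrSchild.waveOperator (fun _ ↦ Kerr.etaComp) φ z = 0 by
      rw [h0, zero_add]
    by_cases hR : R₀ ≤ E4.spatialNorm z
    · rw [hwave z hz.le hR, mul_zero]
    · have : χ z = 0 := (hχ0 z (by push Not at hR; linarith)).eq_of_nhds
      rw [this, zero_mul]
  -- a vanishing criterion
  have hvanish : (KerrSchild.waveOperator (fun _ ↦ Kerr.etaComp) (fun y ↦ χ y * φ y)) =ᶠ[𝓝 y]
      (fun _ ↦ (0 : ℝ)) →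
      KerrSchild.waveOperator (fun _ ↦ Kerr.etaComp)
        (fun z ↦ iteratedFDeriv ℝ m (fun y ↦ χ y * φ y) z v) y = 0 := by
    intro hev
    rw [key, (hev.iteratedFDeriv ℝ m).eq_of_nhds]
    simp
  refine ⟨fun hy ↦ ?_, fun hy ↦ ?_, fun hy hy' ↦ ?_⟩
  · -- the bound on `{y⁰ > T}`
    have hV : IsOpen {z : E4 | T < z 0} := isOpen_lt continuous_const hc0
    have hev : (KerrSchild.waveOperator (fun _ ↦ Kerr.etaComp) (fun y ↦ χ y * φ y)) =ᶠ[𝓝 y]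
        fun z ↦ φ z * KerrSchild.waveOperator (fun _ ↦ Kerr.etaComp) χ z +
          (2 : ℝ) • ∑ μ, Kerr.etaComp μ μ * fderiv ℝ χ z (E4.basisVector μ) *
            fderiv ℝ φ z (E4.basisVector μ) := by
      filter_upwards [hV.mem_nhds hy] with z hz
      exact hsource z hz
    rw [key, (hev.iteratedFDeriv ℝ m).eq_of_nhds]
    -- smoothness of the pieces
    have hWχ : ContDiff ℝ ∞ (KerrSchild.waveOperator (fun _ ↦ Kerr.etaComp) χ) :=
      contDiff_waveEta hχ
    have hF : ContDiff ℝ ∞ fun z ↦ φ z * KerrSchild.waveOperator (fun _ ↦ Kerr.etaComp) χ z :=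
      hφ.mul hWχ
    have hw : ∀ μ : Fin 4, ContDiff ℝ ∞ fun z ↦
        Kerr.etaComp μ μ * fderiv ℝ χ z (E4.basisVector μ) :=
      fun μ ↦ contDiff_const.mul (contDiff_dir hχ _)
    have hG : ∀ μ : Fin 4, ContDiff ℝ ∞ fun z ↦
        Kerr.etaComp μ μ * fderiv ℝ χ z (E4.basisVector μ) * fderiv ℝ φ z (E4.basisVector μ) :=
      fun μ ↦ (hw μ).mul (contDiff_dir hφ _)
    have hS : ContDiff ℝ ∞ fun z ↦ ∑ μ,
        Kerr.etaComp μ μ * fderiv ℝ χ z (E4.basisVector μ) * fderiv ℝ φ z (E4.basisVector μ) :=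
      ContDiff.sum fun μ _ ↦ hG μ
    have hle : ∀ {f : E4 → ℝ}, ContDiff ℝ ∞ f → ContDiffAt ℝ (m : ℕ∞ω) f y :=
      fun hf ↦ (hf.of_le (by exact_mod_cast le_top)).contDiffAt
    have hfg : (fun z ↦ φ z * KerrSchild.waveOperator (fun _ ↦ Kerr.etaComp) χ z +
        (2 : ℝ) • ∑ μ, Kerr.etaComp μ μ * fderiv ℝ χ z (E4.basisVector μ) *
          fderiv ℝ φ z (E4.basisVector μ)) =
        (fun z ↦ φ z * KerrSchild.waveOperator (fun _ ↦ Kerr.etaComp) χ z) + fun z ↦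
          (2 : ℝ) • ∑ μ, Kerr.etaComp μ μ * fderiv ℝ χ z (E4.basisVector μ) *
            fderiv ℝ φ z (E4.basisVector μ) := rfl
    have h2S : ContDiff ℝ ∞ fun z ↦ (2 : ℝ) • ∑ μ, Kerr.etaComp μ μ *
        fderiv ℝ χ z (E4.basisVector μ) * fderiv ℝ φ z (E4.basisVector μ) :=
      hS.const_smul (2 : ℝ)
    rw [hfg, iteratedFDeriv_add_apply (hle hF) (hle h2S),
      iteratedFDeriv_const_smul_apply' (hle hS),
      iteratedFDeriv_fun_sum_apply fun μ _ ↦ hle (hG μ)]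
    simp only [_root_.add_apply]
    -- bounds on the cutoff pieces
    have hK₁ : ∀ k ≤ 2, ∀ z, ‖iteratedFDeriv ℝ k
        (KerrSchild.waveOperator (fun _ ↦ Kerr.etaComp) χ) z‖ ≤ 4 * K₀ := by
      intro k hk z
      calc _ ≤ 4 * ‖iteratedFDeriv ℝ (k + 2) χ z‖ := norm_iteratedFDeriv_waveEta_le hχ k z
        _ ≤ 4 * K₀ := by gcongr; exact hK₀ _ (by omega) _
    have hK₂ : ∀ μ : Fin 4, ∀ k ≤ 2, ∀ z, ‖iteratedFDeriv ℝ k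
        (fun z ↦ Kerr.etaComp μ μ * fderiv ℝ χ z (E4.basisVector μ)) z‖ ≤ K₀ := by
      intro μ k hk z
      have hs : (fun z ↦ Kerr.etaComp μ μ * fderiv ℝ χ z (E4.basisVector μ)) =
          fun z ↦ Kerr.etaComp μ μ • fderiv ℝ χ z (E4.basisVector μ) := by
        funext z; rfl
      rw [hs, iteratedFDeriv_const_smul_apply'
        (((contDiff_dir hχ _).of_le (by exact_mod_cast le_top)).contDiffAt (n := (k : ℕ∞ω))),
        norm_smul, Real.norm_eq_abs, abs_etaComp_diag, one_mul]
      calc _ ≤ ‖E4.basisVector μ‖ * ‖iteratedFDeriv ℝ (k + 1) χ z‖ :=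
            norm_iteratedFDeriv_dir_le hχ _ k z
        _ ≤ K₀ := by rw [norm_basisVector, one_mul]; exact hK₀ _ (by omega) _
    set S := ∑ j ∈ Finset.range 4, ‖iteratedFDeriv ℝ j φ y‖ with hSdef
    have hS0 : 0 ≤ S := Finset.sum_nonneg fun _ _ ↦ norm_nonneg _
    have hA : ‖iteratedFDeriv ℝ m
        (fun z ↦ φ z * KerrSchild.waveOperator (fun _ ↦ Kerr.etaComp) χ z) y‖ ≤
        4 * (4 * K₀) * S :=
      norm_iteratedFDeriv_mul_bdd_le hφ hWχ hK₁ hm y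
    have hB : ∀ μ : Fin 4, ‖iteratedFDeriv ℝ m (fun z ↦
        Kerr.etaComp μ μ * fderiv ℝ χ z (E4.basisVector μ) * fderiv ℝ φ z (E4.basisVector μ)) y‖ ≤
        12 * K₀ * S :=
      fun μ ↦ norm_iteratedFDeriv_bdd_mul_dir_le hφ (hw μ) (hK₂ μ) (norm_basisVector μ) hm y
    have hnorm : ‖iteratedFDeriv ℝ m
          (fun z ↦ φ z * KerrSchild.waveOperator (fun _ ↦ Kerr.etaComp) χ z) y +
        (2 : ℝ) • ∑ μ, iteratedFDeriv ℝ m (fun z ↦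
          Kerr.etaComp μ μ * fderiv ℝ χ z (E4.basisVector μ) *
            fderiv ℝ φ z (E4.basisVector μ)) y‖ ≤ 112 * K₀ * S := by
      refine (norm_add_le _ _).trans ?_
      rw [norm_smul, Real.norm_eq_abs, abs_of_pos (by norm_num : (0 : ℝ) < 2)]
      have hsum := norm_sum_le (Finset.univ : Finset (Fin 4)) fun μ ↦ iteratedFDeriv ℝ m (fun z ↦
          Kerr.etaComp μ μ * fderiv ℝ χ z (E4.basisVector μ) *
            fderiv ℝ φ z (E4.basisVector μ)) y
      have hsum' : ∑ μ : Fin 4, ‖iteratedFDeriv ℝ m (fun z ↦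
          Kerr.etaComp μ μ * fderiv ℝ χ z (E4.basisVector μ) *
            fderiv ℝ φ z (E4.basisVector μ)) y‖ ≤ ∑ _μ : Fin 4, 12 * K₀ * S :=
        Finset.sum_le_sum fun μ _ ↦ hB μ
      simp only [Finset.sum_const, Finset.card_univ, Fintype.card_fin, nsmul_eq_mul,
        Nat.cast_ofNat] at hsum'
      nlinarith [hsum, hsum', hA, hK₀0, hS0]
    calc |(iteratedFDeriv ℝ m
            (fun z ↦ φ z * KerrSchild.waveOperator (fun _ ↦ Kerr.etaComp) χ z) y +
          (2 : ℝ) • ∑ μ, iteratedFDeriv ℝ m (fun z ↦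
            Kerr.etaComp μ μ * fderiv ℝ χ z (E4.basisVector μ) *
              fderiv ℝ φ z (E4.basisVector μ)) y) v|
        ≤ ‖iteratedFDeriv ℝ m
            (fun z ↦ φ z * KerrSchild.waveOperator (fun _ ↦ Kerr.etaComp) χ z) y +
          (2 : ℝ) • ∑ μ, iteratedFDeriv ℝ m (fun z ↦
            Kerr.etaComp μ μ * fderiv ℝ χ z (E4.basisVector μ) *
              fderiv ℝ φ z (E4.basisVector μ)) y‖ * ∏ i, ‖v i‖ := by
          rw [← Real.norm_eq_abs]
          exact ContinuousMultilinearMap.le_opNorm _ _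
      _ ≤ 112 * K₀ * S * ∏ i, ‖v i‖ :=
          mul_le_mul_of_nonneg_right hnorm (Finset.prod_nonneg fun i _ ↦ norm_nonneg (v i))
  · -- inside the cylinder: `ψ = 0` near `y`
    refine hvanish ?_
    have h0 : ∀ᶠ z in 𝓝 y, (fun y ↦ χ y * φ y) z = (fun _ ↦ (0 : ℝ)) z := by
      filter_upwards [hχ0 y hy] with z hz
      simp [hz]
    filter_upwards [h0.eventually_nhds] with z hz
    exact waveEta_eq_zero_of_eventuallyEq hz
  · -- far outside, late: `ψ = φ` near `y` and `□φ = 0` near `y`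
    refine hvanish ?_
    have h1 : ∀ᶠ z in 𝓝 y, T < z 0 := (hc0.tendsto y).eventually_const_lt hy
    have h2 : ∀ᶠ z in 𝓝 y, R₀ + 2 / 3 < E4.spatialNorm z :=
      ((continuous_norm.comp E4.spatial.continuous).tendsto y).eventually_const_lt hy'
    filter_upwards [h1, h2] with z hz1 hz2
    rw [waveEta_congr (hψφ z hz2)]
    exact hwave z hz1.le (by linarith)

/-! ### Registered sub-goal -/

/-- Registered sub-goal of `stub_huygensNeck` (cutoff and source bound): statement of
`exists_cutoff_source`. -/
theorem stub_huygensNeck_cutoffSource : ∀ (φ : E4 → ℝ) (T R₀ : ℝ), 0 < R₀ → ContDiff ℝ ∞ φ → (∀ y : E4, T ≤ y 0 → R₀ ≤ E4.spatialNorm y → KerrSchild.waveOperator (fun _ ↦ Kerr.etaComp) φ y = 0) → ∃ ψ : E4 → ℝ, ContDiff ℝ ∞ ψ ∧ (∀ y, R₀ + 2 / 3 < E4.spatialNorm y → ψ =ᶠ[𝓝 y] φ) ∧ ∃ K : ℝ, 0 ≤ K ∧ ∀ (m : ℕ), m ≤ 2 → ∀ (v : Fin m → E4) (y : E4), (T <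 y 0 → |KerrSchild.waveOperator (fun _ ↦ Kerr.etaComp) (fun z ↦ iteratedFDeriv ℝ m ψ z v) y| ≤ K * (∑ j ∈ Finset.range 4, ‖iteratedFDeriv ℝ j φ y‖) * ∏ i, ‖v i‖) ∧ (E4.spatialNorm y < R₀ + 1 / 3 → KerrSchild.waveOperator (fun _ ↦ Kerr.etaComp) (fun z ↦ iteratedFDeriv ℝ m ψ z v) y = 0) ∧ (T < y 0 → R₀ + 2 / 3 < E4.spatialNorm y → KerrSchild.waveOperator (fun _ ↦ Kerr.etaComp) (fun z ↦ iteratedFDeriv ℝ m ψ z v) y = 0) :=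
  fun _ _ _ hR₀ hφ hwave ↦ exists_cutoff_source hR₀ hφ hwave

end Summit.FinalStateConjecture.FinalStateConjecture.Theorems.NecksCertifyTwoCap.Huygens
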